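import Literature.MathematicalPhysics.QuantumManyBody.BoseGasWallCutoff
import Literature.MathematicalPhysics.QuantumManyBody.PeriodicBoseGas
import HarnessLib

/-!
# `BecUvTail` (stmt-AtomisticToContinuum-8823), line `Sketch` — registered stub `stub_cutoff`

Helper for the crux skeleton `Cruxes/BecUvTail/Lines/Sketch.lean` of route `BECInfraredBound`
(`AtomisticToContinuum/BoseEinsteinCondensation`): proves the registered stub `stub_cutoff` verbatim.
For `0 < s` and `4s ≤ ℓ` we construct a `C¹` cut-off `χ : ℝ³ → [0, 1]` of the periodic cell
`cell ℓ = [0, ℓ)³` with `χ = 1` and `∂ⱼχ = 0` on the closed inner cube `[s, ℓ - s]³`, compact support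
with `tsupport χ ⊆ [s/2, ℓ - s/2]³ ⊆ cell ℓ`, and coordinate slopes `|∂ⱼχ| ≤ 2π/s`. It is the product
`χ(x) = ∏ⱼ θ(xⱼ)` of the one-dimensional plateau `θ = (1 - P) · Q`, where `P` and `Q` are the explicit
`C¹` wall profiles of `WallCutoff.exists_wallProfile` (`BoseGasWallCutoff.lean`) with ramp width `s/2`:
`P = 1` on `(-∞, s/2]`, `P = 0` on `[s, ∞)`, `Q = 1` on `(-∞, ℓ - s]`, `Q = 0` on `[ℓ - s/2, ∞)`,
`|P'|, |Q'| ≤ π/s`; the partial derivatives of the product are computed with `HasFDerivAt.finsetProd`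
(as in `fderiv_prodCutoff_single` of `DiluteBoseGasUpperBoundLocalization.lean`). Standard calculus,
tagged folklore; the variational set-up it serves is [LSSY2005, Ch. 2].
-/

noncomputable section

open MeasureTheory Filter
open scoped ENNReal NNReal BigOperators

namespace Summit.AtomisticToContinuum.BoseEinsteinCondensation.Theorems.BecUvTail

open Literature.MathematicalPhysics.QuantumManyBody.BoseGas

/-- **The one-dimensional plateau.** For `0 < s` (and any `ℓ`) there is a `C¹` function
`θ : ℝ → [0, 1]` with `|θ'| ≤ 2π/s`, `θ = 1` and `θ' = 0` on `[s, ℓ - s]`, and `θ = 0` off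
`(s/2, ℓ - s/2)`: namely `θ = (1 - P) · Q` with the wall profiles `P` (ramp `[s/2, s]`) and `Q`
(ramp `[ℓ - s, ℓ - s/2]`) of `WallCutoff.exists_wallProfile`; `P' = 0` on `[s, ∞)` because every
point there is a minimum of `P ≥ 0`. [folklore] -/
private theorem exists_plateauProfile (ℓ : ℝ) {s : ℝ} (hs : 0 < s) :
    ∃ θ : ℝ → ℝ, ContDiff ℝ 1 θ ∧ (∀ t, 0 ≤ θ t ∧ θ t ≤ 1) ∧
      (∀ t, |deriv θ t| ≤ 2 * Real.pi / s) ∧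
      (∀ t, t ∈ Set.Icc s (ℓ - s) → θ t = 1) ∧
      (∀ t, t ∈ Set.Icc s (ℓ - s) → deriv θ t = 0) ∧
      (∀ t, θ t ≠ 0 → t ∈ Set.Ioo (s / 2) (ℓ - s / 2)) := by
  have hw : 0 < s / 2 := by positivity
  obtain ⟨P, hPc, hP01, hPd, -, hP1, hP0⟩ := WallCutoff.exists_wallProfile (L := 3 * s / 2) hw
  obtain ⟨Q, hQc, hQ01, hQd, hQd0, hQ1, hQ0⟩ := WallCutoff.exists_wallProfile (L := ℓ) hw
  rw [show 2 * (s / 2) = s by ring] at hPd hQd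
  -- `P' = 0` on `[s, ∞)`: there `P = 0 ≤ P` is minimal
  have hPd0 : ∀ t, s ≤ t → deriv P t = 0 := by
    intro t ht
    have hPt : P t = 0 := hP0 t (by linarith)
    refine IsLocalMin.deriv_eq_zero (Filter.Eventually.of_forall fun y => ?_)
    rw [hPt]
    exact (hP01 y).1
  -- `Q' = 0` on `(-∞, ℓ - s]`
  have hQd0' : ∀ t, t ≤ ℓ - s → deriv Q t = 0 := by
    intro t ht
    by_contra h
    have h' := hQd0 t h
    rw [Set.mem_Ioi] at h'
    linarith
  have hPdiff : Differentiable ℝ P := hPc.differentiable one_ne_zero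
  have hQdiff : Differentiable ℝ Q := hQc.differentiable one_ne_zero
  have hθd : ∀ t, deriv (fun t => (1 - P t) * Q t) t =
      -deriv P t * Q t + (1 - P t) * deriv Q t := fun t =>
    (((hPdiff t).hasDerivAt.const_sub 1).mul (hQdiff t).hasDerivAt).deriv
  refine ⟨fun t => (1 - P t) * Q t, (contDiff_const.sub hPc).mul hQc, fun t => ?_, fun t => ?_,
    fun t ht => ?_, fun t ht => ?_, fun t ht => ?_⟩
  · exact ⟨mul_nonneg (sub_nonneg.2 (hP01 t).2) (hQ01 t).1,
      mul_le_one₀ (sub_le_self _ (hP01 t).1) (hQ01 t).1 (hQ01 t).2⟩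
  · rw [hθd t]
    calc |-deriv P t * Q t + (1 - P t) * deriv Q t|
        ≤ |-deriv P t * Q t| + |(1 - P t) * deriv Q t| := abs_add_le _ _
      _ = |deriv P t| * Q t + (1 - P t) * |deriv Q t| := by
          rw [abs_mul, abs_mul, abs_neg, abs_of_nonneg (hQ01 t).1,
            abs_of_nonneg (sub_nonneg.2 (hP01 t).2)]
      _ ≤ Real.pi / s * 1 + 1 * (Real.pi / s) :=
          add_le_add (mul_le_mul (hPd t) (hQ01 t).2 (hQ01 t).1 (by positivity))
            (mul_le_mul (sub_le_self _ (hP01 t).1) (hQd t) (abs_nonneg _) zero_le_one)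
      _ = 2 * Real.pi / s := by ring
  · show (1 - P t) * Q t = 1
    rw [hP0 t (by linarith [ht.1]), hQ1 t (by linarith [ht.2])]
    norm_num
  · rw [hθd t, hPd0 t ht.1, hQd0' t (by linarith [ht.2])]
    ring
  · rw [Set.mem_Ioo]
    by_contra hmem
    rw [not_and_or, not_lt, not_lt] at hmem
    apply ht
    show (1 - P t) * Q t = 0
    rcases hmem with h | h
    · rw [hP1 t (by linarith), sub_self, zero_mul]
    · rw [hQ0 t (by linarith), mul_zero]

/-- **Partial derivatives of the product cut-off on `ℝ³`.** For `C¹` `θ`,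
`∂ⱼ ∏ᵢ θ(xᵢ) = θ'(xⱼ) ∏_{i ≠ j} θ(xᵢ)` (one-particle version of `fderiv_prodCutoff_single`).
[folklore] -/
private theorem fderiv_prod_single {θ : ℝ → ℝ} (hθ : ContDiff ℝ 1 θ)
    (x : EuclideanSpace ℝ (Fin 3)) (j : Fin 3) :
    fderiv ℝ (fun x : EuclideanSpace ℝ (Fin 3) => ∏ i, θ (x i)) x (EuclideanSpace.single j 1) =
      deriv θ (x j) * ∏ i ∈ Finset.univ.erase j, θ (x i) := by
  -- adapted from `fderiv_prodCutoff_single` (DiluteBoseGasUpperBoundLocalization.lean)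
  have hfac : ∀ i : Fin 3, HasFDerivAt (fun x : EuclideanSpace ℝ (Fin 3) => θ (x i))
      (deriv θ (x i) • (PiLp.proj 2 (fun _ : Fin 3 => ℝ) i : EuclideanSpace ℝ (Fin 3) →L[ℝ] ℝ))
      x := fun i =>
    ((hθ.differentiable one_ne_zero) (x i)).hasDerivAt.comp_hasFDerivAt x
      (PiLp.hasFDerivAt_apply (𝕜 := ℝ) 2 x i)
  have hprod := HasFDerivAt.finsetProd (u := Finset.univ) fun i _ => hfac i
  rw [hprod.fderiv]
  simp only [FunLike.coe_sum, Finset.sum_apply, FunLike.coe_smul, Pi.smul_apply, PiLp.proj_apply, PiLp.single_apply, smul_eq_mul, mul_ite, mul_one, mul_zero,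
    Finset.sum_ite_eq', Finset.mem_univ, if_true]
  ring

/-- **A `C¹` cut-off of the periodic cell with controlled slopes** (registered stub `stub_cutoff` of
stmt-AtomisticToContinuum-8823, verbatim). For `0 < s` and `4s ≤ ℓ` there is `χ : ℝ³ → ℝ`, `C¹`,
compactly supported with `tsupport χ ⊆ cell ℓ = [0, ℓ)³`, values in `[0, 1]`, `χ = 1` on the closed
inner cube `{s ≤ xⱼ ≤ ℓ - s}`, coordinate slopes `|∂ⱼχ| ≤ 2π/s`, and `∂ⱼχ = 0` on the inner cube.
Construction: `χ(x) = ∏ⱼ θ(xⱼ)` with the plateau `θ` of `exists_plateauProfile` (`θ ∈ [0,1]`,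
`|θ'| ≤ 2π/s`, `θ = 1`, `θ' = 0` on `[s, ℓ - s]`, `θ = 0` off `(s/2, ℓ - s/2)`); then
`∂ⱼχ(x) = θ'(xⱼ) ∏_{i ≠ j} θ(xᵢ)` (`fderiv_prod_single`), the other factors lie in `[0, 1]`
(`WallCutoff.prod_mem_unit`), and `support χ ⊆ [s/2, ℓ - s/2]³`, a compact subset of the cell.
The hypothesis `4s ≤ ℓ` (which makes the inner cube non-empty) is not used by the construction.
[folklore] -/
theorem stub_cutoff :
    ∀ (ℓ s : ℝ), 0 < s → 4 * s ≤ ℓ → ∃ χ : EuclideanSpace ℝ (Fin 3) → ℝ, ContDiff ℝ 1 χ ∧ HasCompactSupport χ ∧ tsupport χ ⊆ Literature.MathematicalPhysics.QuantumManyBody.BoseGas.cell ℓ ∧ (∀ x, 0 ≤ χ x ∧ χ x ≤ 1) ∧ (∀ x : EuclideanSpace ℝ (Fin 3), (∀ j, x j ∈ Set.Icc s (ℓ - s)) → χ x = 1) ∧ (∀ (x : EuclideanSpace ℝ (Fin 3)) (j : Fin 3), |fderiv ℝ χ x (EuclideanSpace.single j 1)| ≤ 2 * Real.pi / s) ∧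 (∀ x : EuclideanSpace ℝ (Fin 3), (∀ j, x j ∈ Set.Icc s (ℓ - s)) → ∀ j : Fin 3, fderiv ℝ χ x (EuclideanSpace.single j 1) = 0) := by
  intro ℓ s hs hℓ
  obtain ⟨θ, hθc, hθ01, hθd, hθ1, hθd0, hθsupp⟩ := exists_plateauProfile ℓ hs
  -- the compact box `[s/2, ℓ - s/2]³` carrying the support
  set K : Set (EuclideanSpace ℝ (Fin 3)) :=
    (WithLp.toLp 2 '' Set.univ.pi fun _ : Fin 3 => Set.Icc (s / 2) (ℓ - s / 2)) with hK
  have hKc : IsCompact K :=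
    (isCompact_univ_pi fun _ => isCompact_Icc).image (PiLp.continuous_toLp 2 _)
  have hsuppK : Function.support (fun x : EuclideanSpace ℝ (Fin 3) => ∏ j, θ (x j)) ⊆ K := by
    intro x hx
    refine ⟨WithLp.ofLp x, fun j _ => ?_, rfl⟩
    have hj : θ (x j) ≠ 0 := fun h0 => hx (Finset.prod_eq_zero (Finset.mem_univ j) h0)
    exact Set.Ioo_subset_Icc_self (hθsupp _ hj)
  have hKcell : K ⊆ cell ℓ := by
    rintro _ ⟨y, hy, rfl⟩ k
    obtain ⟨h1, h2⟩ := hy k (Set.mem_univ k)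
    rw [PiLp.toLp_apply]
    exact ⟨by linarith, by linarith⟩
  refine ⟨fun x => ∏ j, θ (x j), by fun_prop,
    hKc.of_isClosed_subset (isClosed_tsupport _) (closure_minimal hsuppK hKc.isClosed),
    (closure_minimal hsuppK hKc.isClosed).trans hKcell,
    fun x => WallCutoff.prod_mem_unit Finset.univ (fun j => θ (x j)) fun j => hθ01 _,
    fun x hx => Finset.prod_eq_one fun j _ => hθ1 _ (hx j), fun x j => ?_, fun x hx j => ?_⟩
  · rw [fderiv_prod_single hθc x j, abs_mul]
    have hP := WallCutoff.prod_mem_unit (Finset.univ.erase j) (fun i => θ (x i)) fun i => hθ01 _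
    rw [abs_of_nonneg hP.1]
    calc |deriv θ (x j)| * ∏ i ∈ Finset.univ.erase j, θ (x i) ≤ 2 * Real.pi / s * 1 :=
          mul_le_mul (hθd _) hP.2 hP.1 (by positivity)
      _ = 2 * Real.pi / s := mul_one _
  · rw [fderiv_prod_single hθc x j, hθd0 _ (hx j), zero_mul]

end Summit.AtomisticToContinuum.BoseEinsteinCondensation.Theorems.BecUvTail

end
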